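import Summits.CriticalPhenomena.SAWScalingLimit.Theses.SAWPoissonHoneycomb

/-!
Sketch — typed split of the crux `DensityUniversality` (stmt-CriticalPhenomena-6936) of route
SAWPoissonHoneycomb into `DUBulk` (compactly supported smooth interior density perturbations are
invisible) and `DUCollar` (collar-modification stability), with the assembly
`DensityUniversality_of_subs : DUBulk → DUCollar → DensityUniversality`.
-/

namespace Summit.CriticalPhenomena.SAWScalingLimit.Theses.SAWPoissonHoneycomb

/-- piece X₁ (crux): DU restricted to densities that are C² on ℂ and identically 1 on a
neighbourhood of ∂D and outside D (tsupport (ρ - 1) ⊆ D). -/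
def DUBulk : Prop :=
  ∀ (Pois : MeasureTheory.Measure ℂ → MeasureTheory.Measure (Literature.Analysis.FunctionSpaces.PointConfig ℂ)), (∀ ν : MeasureTheory.Measure ℂ, MeasureTheory.IsLocallyFiniteMeasure ν → (∀ z : ℂ, ν {z} = 0) → Literature.Analysis.FunctionSpaces.IsPoissonPointProcess ν (Pois ν)) → let S : Literature.Analysis.FunctionSpaces.PointConfig ℂ → ℂ → Set ℂ := fun ω c => (ω : Set ℂ) ∩ Metric.sphere c (Metric.infDist c (ω : Set ℂ)); let vor : Literature.Analysis.FunctionSpaces.PointConfig ℂ → SimpleGraph ℂ := fun ω => SimpleGraph.fromRel fun c c' => 3 ≤ (S ω c).encard ∧ 3 ≤ (S ω c').encard ∧ (S ω c ∩ S ω c').encard = 2; let μ : ENNReal := essSup (fun ω => Filter.limsup (fun n : ℕ => (⨆ c : Metric.closedBall (0 : ℂ) 1, (Literature.Probability.RandomPlanarGeometry.SAW.sawCount (vor ω) (c : ℂ) n : ENNReal)) ^ (1 / (n : ℝ))) Filter.atTop) (Pois MeasureTheory.volume); let xc : ℝ := (μ.toReal)⁻¹; let near : Literature.Analysis.FunctionSpaces.PointConfig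 ℂ → Set ℂ → ℂ → ℂ := fun ω Ω z => Classical.epsilon fun v : ℂ => v ∈ Literature.Probability.RandomPlanarGeometry.SAW.embMeshDomain (vor ω) id Ω 1 ∧ ∀ w ∈ Literature.Probability.RandomPlanarGeometry.SAW.embMeshDomain (vor ω) id Ω 1, dist v z ≤ dist w z; let intens : (ℂ → ℝ) → ℝ → MeasureTheory.Measure ℂ := fun ρ δ => ENNReal.ofReal (δ⁻¹ ^ 2) • MeasureTheory.volume.withDensity fun z => ENNReal.ofReal (ρ z); let qlaw : Literature.Probability.RandomPlanarGeometry.DobrushinDomain → Literature.Analysis.FunctionSpaces.PointConfig ℂ → MeasureTheory.Measure (Literature.Probability.RandomPlanarGeometry.CurveClass ℂ) := fun D ω => (Literature.Probability.RandomPlanarGeometry.SAW.embLaw (vor ω) id D.carrier 1 xc (near ω D.carrier (D.pt 0)) (near ω D.carrier (D.pt 1))).map fun γ => γ.curve; let Q : (ℂ → ℝ) → Literature.Probability.RandomPlanarGeometry.DobrushinDomain → ℝ → MeasureTheory.Measure (Literature.Probability.RandomPlanarGeometry.CurveClass ℂ) := fun ρ D δ => (Pois (intens ρ δ)).bind (qlaw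 D); ∀ (D : Literature.Probability.RandomPlanarGeometry.DobrushinDomain) (ρ : ℂ → ℝ), ContDiffOn ℝ 2 ρ D.carrier → (∀ z ∈ D.carrier, 0 < ρ z) → (∀ z ∉ D.carrier, ρ z = 1) → MeasureTheory.IntegrableOn ρ D.carrier → ContDiff ℝ 2 ρ → tsupport (fun z => ρ z - 1) ⊆ D.carrier → ∀ f : BoundedContinuousFunction (Literature.Probability.RandomPlanarGeometry.CurveClass ℂ) ℝ, Filter.Tendsto (fun δ => (∫ x, f x ∂(Q ρ D δ)) - ∫ x, f x ∂(Q (fun _ => 1) D δ)) (nhdsWithin 0 (Set.Ioi 0)) (nhds 0)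

/-- piece X₂ (crux): collar-modification stability. -/
def DUCollar : Prop :=
  ∀ (Pois : MeasureTheory.Measure ℂ → MeasureTheory.Measure (Literature.Analysis.FunctionSpaces.PointConfig ℂ)), (∀ ν : MeasureTheory.Measure ℂ, MeasureTheory.IsLocallyFiniteMeasure ν → (∀ z : ℂ, ν {z} = 0) → Literature.Analysis.FunctionSpaces.IsPoissonPointProcess ν (Pois ν)) → let S : Literature.Analysis.FunctionSpaces.PointConfig ℂ → ℂ → Set ℂ := fun ω c => (ω : Set ℂ) ∩ Metric.sphere c (Metric.infDist c (ω : Set ℂ)); let vor : Literature.Analysis.FunctionSpaces.PointConfig ℂ → SimpleGraph ℂ := fun ω => SimpleGraph.fromRel fun c c' => 3 ≤ (S ω c).encard ∧ 3 ≤ (S ω c').encard ∧ (S ω c ∩ S ω c').encard = 2; let μ : ENNReal := essSup (fun ω => Filter.limsup (fun n : ℕ => (⨆ c : Metric.closedBall (0 : ℂ) 1, (Literature.Probability.RandomPlanarGeometry.SAW.sawCount (vor ω) (c : ℂ) n : ENNReal)) ^ (1 / (n : ℝ))) Filter.atTop) (Pois MeasureTheory.volume); let xc : ℝ := (μ.toReal)⁻¹;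 let near : Literature.Analysis.FunctionSpaces.PointConfig ℂ → Set ℂ → ℂ → ℂ := fun ω Ω z => Classical.epsilon fun v : ℂ => v ∈ Literature.Probability.RandomPlanarGeometry.SAW.embMeshDomain (vor ω) id Ω 1 ∧ ∀ w ∈ Literature.Probability.RandomPlanarGeometry.SAW.embMeshDomain (vor ω) id Ω 1, dist v z ≤ dist w z; let intens : (ℂ → ℝ) → ℝ → MeasureTheory.Measure ℂ := fun ρ δ => ENNReal.ofReal (δ⁻¹ ^ 2) • MeasureTheory.volume.withDensity fun z => ENNReal.ofReal (ρ z); let qlaw : Literature.Probability.RandomPlanarGeometry.DobrushinDomain → Literature.Analysis.FunctionSpaces.PointConfig ℂ → MeasureTheory.Measure (Literature.Probability.RandomPlanarGeometry.CurveClass ℂ) := fun D ω => (Literature.Probability.RandomPlanarGeometry.SAW.embLaw (vor ω) id D.carrier 1 xc (near ω D.carrier (D.pt 0)) (near ω D.carrier (D.pt 1))).map fun γ => γ.curve; let Q : (ℂ → ℝ) → Literature.Probability.RandomPlanarGeometry.DobrushinDomain → ℝ → MeasureTheory.Measure (Literature.Probability.RandomPlanarGeometry.CurveClass ℂ) :=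 fun ρ D δ => (Pois (intens ρ δ)).bind (qlaw D); ∀ (D : Literature.Probability.RandomPlanarGeometry.DobrushinDomain) (ρ : ℂ → ℝ), ContDiffOn ℝ 2 ρ D.carrier → (∀ z ∈ D.carrier, 0 < ρ z) → (∀ z ∉ D.carrier, ρ z = 1) → MeasureTheory.IntegrableOn ρ D.carrier → ∀ (f : BoundedContinuousFunction (Literature.Probability.RandomPlanarGeometry.CurveClass ℂ) ℝ) (η : ℝ), 0 < η → ∃ ε : ℝ, 0 < ε ∧ ∀ ρ' : ℂ → ℝ, ContDiffOn ℝ 2 ρ' D.carrier → (∀ z ∈ D.carrier, 0 < ρ' z) → (∀ z ∉ D.carrier, ρ' z = 1) → MeasureTheory.IntegrableOn ρ' D.carrier → Set.EqOn ρ' ρ {z | z ∈ D.carrier ∧ ε ≤ Metric.infDist z D.carrierᶜ} → ∀ᶠ δ in nhdsWithin 0 (Set.Ioi 0), |(∫ x, f x ∂(Q ρ D δ)) - ∫ x, f x ∂(Q ρ' D δ)| ≤ η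

open scoped Topology
open Set Filter

namespace DensityUniversalitySplit

/-- Smooth Urysohn lemma on `ℂ` (Mathlib's `exists_contMDiffMap_zero_one_of_isClosed` on `ℂ`
regarded as a manifold modelled on itself). [folklore] -/
theorem exists_contDiff_zero_one {s t : Set ℂ} (hs : IsClosed s) (ht : IsClosed t)
    (hd : Disjoint s t) :
    ∃ χ : ℂ → ℝ, ContDiff ℝ 2 χ ∧ (∀ x ∈ s, χ x = 0) ∧ (∀ x ∈ t, χ x = 1) ∧
      ∀ x, χ x ∈ Icc (0 : ℝ) 1 := by
  obtain ⟨f, hf0, hf1, hf⟩ := exists_contMDiffMap_zero_one_of_isClosed (I := modelWithCornersSelf ℝ ℂ) (M := ℂ)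
    (n := (2 : ℕ∞)) hs ht hd
  refine ⟨f, ?_, fun x hx => hf0 hx, fun x hx => hf1 hx, hf⟩
  have h := f.contMDiff.contDiff
  exact_mod_cast h

/-- Triangle-inequality bookkeeping: if `a - b` is eventually at most `η/2` in absolute value and
`b - c → 0`, then eventually `|a - c| < η`. [folklore] -/
theorem eventually_dist_lt_of_abs_sub_le_of_tendsto {l : Filter ℝ} {a b c : ℝ → ℝ} {η : ℝ}
    (hη : 0 < η) (h1 : ∀ᶠ δ in l, |a δ - b δ| ≤ η / 2)
    (h2 : Tendsto (fun δ => b δ - c δ) l (nhds 0)) :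
    ∀ᶠ δ in l, dist (a δ - c δ) 0 < η := by
  have h2' := (Metric.tendsto_nhds.1 h2) (η / 2) (half_pos hη)
  filter_upwards [h1, h2'] with δ hδ1 hδ2
  rw [Real.dist_0_eq_abs] at hδ2 ⊢
  calc |a δ - c δ| = |(a δ - b δ) + (b δ - c δ)| := by ring_nf
    _ ≤ |a δ - b δ| + |b δ - c δ| := abs_add_le _ _
    _ < η := by linarith

/-- **Collar cutoff.** A density `ρ` that is `C²` and positive on the (open, bounded) carrier of a
Dobrushin domain agrees, on the closed inner region `{z ∈ D | ε ≤ dist(z, Dᶜ)}`, with a density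
`ρ'` that is `C²` on all of `ℂ`, positive on `D`, identically `1` off `D` and near `∂D`
(`tsupport (ρ' - 1) ⊆ D`) and integrable on `D`: `ρ' = 1 + χ (ρ - 1)` for a smooth Urysohn
function `χ` equal to `1` on the inner region and to `0` on `{dist(·, Dᶜ) ≤ ε/2}`. [folklore] -/
theorem exists_collar_cutoff (D : Literature.Probability.RandomPlanarGeometry.DobrushinDomain)
    (ρ : ℂ → ℝ) (hρ : ContDiffOn ℝ 2 ρ D.carrier) (hpos : ∀ z ∈ D.carrier, 0 < ρ z)
    {ε : ℝ} (hε : 0 < ε) :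
    ∃ ρ' : ℂ → ℝ, ContDiff ℝ 2 ρ' ∧ tsupport (fun z => ρ' z - 1) ⊆ D.carrier ∧
      (∀ z ∈ D.carrier, 0 < ρ' z) ∧ (∀ z ∉ D.carrier, ρ' z = 1) ∧
      MeasureTheory.IntegrableOn ρ' D.carrier ∧
      Set.EqOn ρ' ρ {z | z ∈ D.carrier ∧ ε ≤ Metric.infDist z D.carrierᶜ} := by
  have hcont : Continuous fun z : ℂ => Metric.infDist z D.carrierᶜ :=
    Metric.continuous_infDist_pt _
  have hS : IsClosed {z : ℂ | Metric.infDist z D.carrierᶜ ≤ ε / 2} :=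
    isClosed_le hcont continuous_const
  have hT : IsClosed {z : ℂ | ε ≤ Metric.infDist z D.carrierᶜ} :=
    isClosed_le continuous_const hcont
  have hST : Disjoint {z : ℂ | Metric.infDist z D.carrierᶜ ≤ ε / 2}
      {z : ℂ | ε ≤ Metric.infDist z D.carrierᶜ} := by
    refine Set.disjoint_left.2 fun z h1 h2 => ?_
    simp only [Set.mem_setOf_eq] at h1 h2
    linarith
  obtain ⟨χ, hχs, hχ0, hχ1, hχ01⟩ := exists_contDiff_zero_one hS hT hST
  -- a point at positive distance from `Dᶜ` lies in `D`
  have memD : ∀ z : ℂ, 0 < Metric.infDist z D.carrierᶜ → z ∈ D.carrier := fun z hz => by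
    by_contra h
    exact (ne_of_gt hz) (Metric.infDist_zero_of_mem (show z ∈ D.carrierᶜ from h))
  -- off `D` the cutoff vanishes
  have hχD : ∀ z, z ∉ D.carrier → χ z = 0 := fun z hz => by
    apply hχ0
    simp only [Set.mem_setOf_eq, Metric.infDist_zero_of_mem (show z ∈ D.carrierᶜ from hz)]
    linarith
  set ρ' : ℂ → ℝ := fun z => 1 + χ z * (ρ z - 1) with hρ'
  have hC2 : ContDiff ℝ 2 ρ' := by
    rw [contDiff_iff_contDiffAt]
    intro z
    by_cases hz : z ∈ D.carrier
    · exact contDiffAt_const.add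
        (hχs.contDiffAt.mul ((hρ.contDiffAt (D.isOpen.mem_nhds hz)).sub contDiffAt_const))
    · have hU : {w : ℂ | Metric.infDist w D.carrierᶜ < ε / 2} ∈ 𝓝 z := by
        refine (isOpen_lt hcont continuous_const).mem_nhds ?_
        simp only [Set.mem_setOf_eq, Metric.infDist_zero_of_mem (show z ∈ D.carrierᶜ from hz)]
        linarith
      refine (contDiffAt_const (c := (1 : ℝ))).congr_of_eventuallyEq ?_
      filter_upwards [hU] with w hw
      have : χ w = 0 := hχ0 w (le_of_lt hw)
      simp [hρ', this]
  refine ⟨ρ', hC2, ?_, ?_, ?_, ?_, ?_⟩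
  · -- tsupport (ρ' - 1) ⊆ {ε/2 ≤ infDist} ⊆ D
    intro z hz
    apply memD
    have hsub : tsupport (fun z => ρ' z - 1) ⊆ {z : ℂ | ε / 2 ≤ Metric.infDist z D.carrierᶜ} := by
      refine closure_minimal ?_ (isClosed_le continuous_const hcont)
      intro w hw
      rw [Function.mem_support] at hw
      by_contra hlt
      simp only [Set.mem_setOf_eq, not_le] at hlt
      exact hw (by simp [hρ', hχ0 w (le_of_lt hlt)])
    have := hsub hz
    simp only [Set.mem_setOf_eq] at this
    linarith
  · -- positivity on D: ρ' = (1 - χ) + χ ρ ≥ min 1 ρ > 0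
    intro z hz
    have h0 : 0 ≤ χ z := (hχ01 z).1
    have h1 : χ z ≤ 1 := (hχ01 z).2
    have hρz : 0 < ρ z := hpos z hz
    have hm : 0 < min 1 (ρ z) := lt_min one_pos hρz
    simp only [hρ']
    nlinarith [min_le_left 1 (ρ z), min_le_right 1 (ρ z),
      mul_nonneg h0 (sub_nonneg.2 (min_le_right 1 (ρ z))),
      mul_nonneg (sub_nonneg.2 h1) (sub_nonneg.2 (min_le_left 1 (ρ z)))]
  · -- ρ' = 1 off D
    intro z hz
    simp [hρ', hχD z hz]
  · -- integrable on the bounded set D (continuous on its compact closure)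
    exact (hC2.continuous.continuousOn.integrableOn_compact
      D.isBounded.isCompact_closure).mono_set subset_closure
  · -- agreement on the inner region
    intro z hz
    have : χ z = 1 := hχ1 z hz.2
    simp [hρ', this]

end DensityUniversalitySplit

open DensityUniversalitySplit in
/-- **Assembly of the split.** `DUBulk ∧ DUCollar → DensityUniversality`: given an admissible
density `ρ`, a test function `f` and `η > 0`, collar stability supplies `ε > 0`; the collar cutoff
`ρ'` of `ρ` (smooth Urysohn function of the distance to `Dᶜ`) is an admissible bulk-class density
agreeing with `ρ` on `{dist(·, Dᶜ) ≥ ε}`, so `|Q_ρ f - Q_ρ' f| ≤ η/2` eventually (collar piece) and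
`Q_ρ' f - Q_1 f → 0` (bulk piece); the triangle inequality gives `|Q_ρ f - Q_1 f| < η`
eventually. [folklore] -/
theorem DensityUniversality_of_subs : DUBulk → DUCollar → DensityUniversality := by
  intro hB hC Pois hPois
  have hB' := hB Pois hPois
  have hC' := hC Pois hPois
  clear hB hC
  intro S vor μ xc near intens qlaw Q D ρ hρ hpos hout hint f
  rw [Metric.tendsto_nhds]
  intro η hη
  obtain ⟨ε, hε, hstab⟩ := hC' D ρ hρ hpos hout hint f (η / 2) (half_pos hη)
  obtain ⟨ρ', hC2, hsupp, hpos', hout', hint', heq⟩ := exists_collar_cutoff D ρ hρ hpos hε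
  have h1 := hstab ρ' hC2.contDiffOn hpos' hout' hint' heq
  have h2 := hB' D ρ' hC2.contDiffOn hpos' hout' hint' hC2 hsupp f
  exact eventually_dist_lt_of_abs_sub_le_of_tendsto hη h1 h2

/-- Converse bookkeeping 1: the bulk piece is a special case of the crux. [folklore] -/
theorem DUBulk_of_DensityUniversality : DensityUniversality → DUBulk := by
  intro h Pois hPois S vor μ xc near intens qlaw Q D ρ hρ hpos hout hint _ _ f
  exact h Pois hPois D ρ hρ hpos hout hint f

/-- Converse bookkeeping 2: the collar piece is a consequence of the crux (both `ρ` and `ρ'` are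
admissible, so both laws are asymptotically equal to the density-1 law). [folklore] -/
theorem DUCollar_of_DensityUniversality : DensityUniversality → DUCollar := by
  intro h Pois hPois S vor μ xc near intens qlaw Q D ρ hρ hpos hout hint f η hη
  refine ⟨1, one_pos, fun ρ' hρ' hpos' hout' hint' _ => ?_⟩
  have ha := h Pois hPois D ρ hρ hpos hout hint f
  have hb := h Pois hPois D ρ' hρ' hpos' hout' hint' f
  have hab := ha.sub hb
  rw [sub_zero] at hab
  have := (Metric.tendsto_nhds.1 hab) η hη
  filter_upwards [this] with δ hδ
  rw [Real.dist_0_eq_abs] at hδ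
  refine le_of_lt ?_
  calc _ = |((∫ x, f x ∂(Q ρ D δ)) - ∫ x, f x ∂(Q (fun _ => 1) D δ)) -
        ((∫ x, f x ∂(Q ρ' D δ)) - ∫ x, f x ∂(Q (fun _ => 1) D δ))| := by ring_nf
    _ < η := hδ

end Summit.CriticalPhenomena.SAWScalingLimit.Theses.SAWPoissonHoneycomb
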